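import Mathlib.NumberTheory.Cyclotomic.CyclotomicCharacter
import Mathlib.RingTheory.RootsOfUnity.AlgebraicallyClosed
import Mathlib.RingTheory.RootsOfUnity.Lemmas
import Mathlib.RingTheory.SimpleModule.Rank
import Mathlib.RepresentationTheory.Semisimple
import Mathlib.NumberTheory.DirichletCharacter.Basic
import Literature.NumberTheory.GaloisRepresentations.GaloisRep
import Literature.NumberTheory.GaloisRepresentations.IntegralGaloisActionProofs
import Literature.NumberTheory.GaloisRepresentations.ModPGaloisRep
import HarnessLib

/-!
# The mod `N` cyclotomic character, Dirichlet characters as Galois characters, and rank-one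
framed representations (proofs)

General material split off from the proof of Deligne–Serre 1974, Rem. 4.4–4.5
(`Literature.NumberTheory.EllipticCurves.NewformGaloisRepOddProofs`), reusable by any consumer
of `Literature.NumberTheory.GaloisRepresentations`:

* `Literature.modNCyclotomicCharacter K N : Γ_K →* (ℤ/Nℤ)ˣ` (`[NeZero (N : K)]`), "l'homomorphisme
  `G → (ℤ/Nℤ)^*` fourni par l'action de `G` sur les racines `N`-ièmes de l'unité"
  (Deligne–Serre 1974, 4.4): Mathlib's `modularCyclotomicCharacter` on `K̄` composed with
  `Γ_K → (K̄ ≃+* K̄)`.  This is the general-`N` version of `Literature.NumberTheory.GaloisRepresentations.modPCyclotomicCharacterZMod`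
  (`Literature.NumberTheory.GaloisRepresentations.ModPGaloisRep`, `N = p` prime), which it
  supersedes: `modPCyclotomicCharacterZMod_eq_modNCyclotomicCharacter` (`rfl`);
  **refactor:** (librarian) turn `modPCyclotomicCharacterZMod` and its lemmas `_spec`,
  `_eq_one_of_mem_fixingSubgroup` and the continuity argument of `modPCyclotomicCharacter` into
  aliases / one-line consequences of the mod-`N` declarations below.  Lemmas: `_spec`,
  `_eq_of_smul_eq_pow` (uniqueness from one primitive root), `_eq_one_of_mem_fixingSubgroup`,
  `_eventually_eq_one` (locally constant).
* `Literature.dirichletGaloisCharacter K ε : Γ_K →ₜ* ℂˣ`, `σ ↦ ε(χ_N(σ))` — a Dirichlet character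
  mod `N` regarded as a continuous character of `Γ_K` ("le composé de `ε` et de
  l'homomorphisme `G → (ℤ/Nℤ)^*`", loc. cit.); finite range.
* Values of `χ_N` for a number field `K` and a prime `𝔓 ∤ N` of `\bar ℤ_K`:
  `modNCyclotomicCharacter_eq_one_of_mem_inertia` (`χ_N(I_𝔓) = 1`),
  `modNCyclotomicCharacter_eq_residueCard_of_isArithFrobAt` (`χ_N(Frob_𝔓) = N v`), and for
  any `K`, `modNCyclotomicCharacter_of_isComplexConjugation` (`χ_N(c) = -1`).  The input is
  that `N`-th roots of unity are distinct modulo `𝔓 ∌ N` in any domain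
  (`IsPrimitiveRoot.pow_eq_pow_of_sub_mem`, from Mathlib's
  `IsPrimitiveRoot.prod_one_sub_pow_eq_order`); for `K = ℚ`,
  `Rat.natCast_not_mem_of_mem_primesAbove_of_not_dvd` (`p ∤ N ⇒ N ∉ 𝔓` for `𝔓 ∣ p`).
* Rank-one framed representations: `FramedRep.ofCharacter χ : FramedRep G A 1` for a continuous
  character `χ : G →ₜ* Aˣ` (`FramedGaloisRep.cyclotomic` of `GaloisRep` is literally this
  construction, `FramedGaloisRep.cyclotomic_eq_ofCharacter`), its entries, injectivity, finite
  range, characteristic polynomial `X - χ(g)`; over a field, rank-one representations are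
  semisimple (`isSemisimple_of_rank_one`) and equivalent ones are equal
  (`eq_of_equiv_of_rank_one`).

## References

* P. Deligne, J.-P. Serre, *Formes modulaires de poids 1*, Ann. Sci. ÉNS (4) 7 (1974), 4.4
  (p. 515) (`DeligneSerreASENS1974`).
* J. Neukirch, *Algebraic Number Theory* (1999), Ch. I §10, (10.3) (`p ∤ N` unramified in
  `ℚ(ζ_N)`, Frobenius `ζ ↦ ζ^p`) (`NeukirchANT1999`).
* L. Washington, *Introduction to Cyclotomic Fields*, GTM 83, Ch. 3 (Dirichlet characters as
  Galois characters; `χ(c) = χ(-1)`).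
-/

noncomputable section

open scoped NumberField IntermediateField
open Field IsDedekindDomain NumberField Polynomial

namespace Literature.NumberTheory.GaloisRepresentations

/-! ### The mod `N` cyclotomic character of `Γ_K` -/

section CyclotomicModN

variable (K : Type*) [Field K] (N : ℕ) [NeZero N] [NeZero (N : K)]

/-- The **mod `N` cyclotomic character** `Γ_K → (ℤ/Nℤ)ˣ`, `σ ζ = ζ ^ {χ_N(σ)}` for all `N`-th
roots of unity `ζ ∈ K̄` ("l'homomorphisme `G → (ℤ/Nℤ)^*` fourni par l'action de `G` sur les
racines `N`-ièmes de l'unité", Deligne–Serre 1974, 4.4): Mathlib's `modularCyclotomicCharacter`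
for `L = AlgebraicClosure K` (which has `N` `N`-th roots of unity as `N ≠ 0` in `K`), composed
with `Γ_K → (K̄ ≃+* K̄)`.  This is the general-`N` version of `Literature.NumberTheory.GaloisRepresentations.modPCyclotomicCharacterZMod`
(`Literature.NumberTheory.GaloisRepresentations.ModPGaloisRep`, `N = p` prime), which it
supersedes (`modPCyclotomicCharacterZMod_eq_modNCyclotomicCharacter`, `rfl`; refactor note in
the module docstring). [folklore] -/
def modNCyclotomicCharacter : absoluteGaloisGroup K →* (ZMod N)ˣ :=
  (modularCyclotomicCharacter (AlgebraicClosure K)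
      (HasEnoughRootsOfUnity.natCard_rootsOfUnity (AlgebraicClosure K) N)).comp
    (MulSemiringAction.toRingAut (absoluteGaloisGroup K) (AlgebraicClosure K))

omit [NeZero N] in
/-- The mod `p` cyclotomic character of `ModPGaloisRep` **is** the mod `N` cyclotomic character
at `N = p` (definitionally).  Refactor target: make the former an alias of the latter. [folklore] -/
theorem modPCyclotomicCharacterZMod_eq_modNCyclotomicCharacter (p : ℕ) [Fact p.Prime]
    [NeZero (p : K)] : modPCyclotomicCharacterZMod K p = modNCyclotomicCharacter K p := rfl

/-- Defining property: `σ • t = t ^ χ_N(σ)` for every `t ∈ K̄` with `t ^ N = 1`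
(Mathlib `modularCyclotomicCharacter.spec`). [folklore] -/
theorem modNCyclotomicCharacter_spec (σ : absoluteGaloisGroup K) (t : AlgebraicClosure K)
    (ht : t ^ N = 1) :
    σ • t = t ^ ((modNCyclotomicCharacter K N σ : ZMod N)).val :=
  modularCyclotomicCharacter.spec (AlgebraicClosure K)
    (HasEnoughRootsOfUnity.natCard_rootsOfUnity (AlgebraicClosure K) N)
    (MulSemiringAction.toRingAut (absoluteGaloisGroup K) (AlgebraicClosure K) σ)
    (t := rootsOfUnity.mkOfPowEq t ht) (rootsOfUnity.mkOfPowEq t ht).2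

/-- Uniqueness: if `σ • ζ = ζ ^ c` for one *primitive* `N`-th root of unity `ζ`, then
`χ_N(σ) = c` (Mathlib `modularCyclotomicCharacter.unique`). [folklore] -/
theorem modNCyclotomicCharacter_eq_of_smul_eq_pow {ζ : AlgebraicClosure K}
    (hζ : IsPrimitiveRoot ζ N) (σ : absoluteGaloisGroup K) {c : ℕ} (h : σ • ζ = ζ ^ c) :
    (modNCyclotomicCharacter K N σ : ZMod N) = c := by
  symm
  refine modularCyclotomicCharacter.unique (AlgebraicClosure K)
    (HasEnoughRootsOfUnity.natCard_rootsOfUnity (AlgebraicClosure K) N) _ fun t ht => ?_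
  obtain ⟨i, -, rfl⟩ := (hζ.isUnit_unit NeZero.out).eq_pow_of_mem_rootsOfUnity ht
  change σ • (ζ ^ i) = (ζ ^ i) ^ (c : ZMod N).val
  rw [smul_pow', h, ← pow_mul, ← pow_mul, mul_comm i, pow_mul, pow_mul, ZMod.val_natCast]
  congr 1
  conv_rhs => rw [hζ.eq_orderOf, pow_mod_orderOf]

/-- The mod `N` cyclotomic character is trivial on `Gal(K̄/K(ζ))`, `ζ` a primitive `N`-th
root of unity. [folklore] -/
theorem modNCyclotomicCharacter_eq_one_of_mem_fixingSubgroup {ζ : AlgebraicClosure K}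
    (hζ : IsPrimitiveRoot ζ N) (σ : absoluteGaloisGroup K)
    (hσ : σ ∈ (IntermediateField.fixingSubgroup K⟮ζ⟯ : Subgroup (absoluteGaloisGroup K))) :
    modNCyclotomicCharacter K N σ = 1 := by
  ext
  rw [Units.val_one, ← Nat.cast_one]
  refine modNCyclotomicCharacter_eq_of_smul_eq_pow K N hζ σ ?_
  rw [pow_one]
  exact hσ ⟨ζ, IntermediateField.mem_adjoin_simple_self K ζ⟩

/-- The mod `N` cyclotomic character is **locally constant** (its kernel contains the open
subgroup `Gal(K̄/K(ζ_N))`, `IntermediateField.fixingSubgroup_isOpen`), hence continuous for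
the discrete topology on `(ℤ/Nℤ)ˣ` — stated as: it is eventually `1` near `1`. [folklore] -/
theorem modNCyclotomicCharacter_eventually_eq_one :
    ∀ᶠ σ in nhds (1 : absoluteGaloisGroup K), modNCyclotomicCharacter K N σ = 1 := by
  obtain ⟨ζ, hζ⟩ := HasEnoughRootsOfUnity.exists_primitiveRoot (AlgebraicClosure K) N
  haveI : FiniteDimensional K K⟮ζ⟯ :=
    IntermediateField.adjoin.finiteDimensional ((hζ.isIntegral (Nat.pos_of_neZero _)).tower_top)
  let U : Set (absoluteGaloisGroup K) :=
    {σ | σ ∈ (IntermediateField.fixingSubgroup K⟮ζ⟯ : Subgroup (absoluteGaloisGroup K))}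
  have hopen : IsOpen U := IntermediateField.fixingSubgroup_isOpen K⟮ζ⟯
  have hU : U ∈ nhds (1 : absoluteGaloisGroup K) :=
    hopen.mem_nhds (one_mem (IntermediateField.fixingSubgroup K⟮ζ⟯))
  filter_upwards [hU] with σ hσ
  exact modNCyclotomicCharacter_eq_one_of_mem_fixingSubgroup K N hζ σ hσ

variable {N}

/-- **A Dirichlet character as a character of `Γ_K`** (Deligne–Serre 1974, 4.4: "le composé
de `ε` et de l'homomorphisme `G → (ℤ/Nℤ)^*`"): `σ ↦ ε(χ_N(σ))`, a continuous homomorphism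
`Γ_K →ₜ* ℂˣ` (locally constant). [folklore] -/
def dirichletGaloisCharacter (ε : DirichletCharacter ℂ N) : absoluteGaloisGroup K →ₜ* ℂˣ where
  toMonoidHom := ε.toUnitHom.comp (modNCyclotomicCharacter K N)
  continuous_toFun := by
    set χ : absoluteGaloisGroup K →* ℂˣ := ε.toUnitHom.comp (modNCyclotomicCharacter K N) with hχ
    change Continuous χ
    refine continuous_of_continuousAt_one χ ?_
    rw [ContinuousAt, map_one]
    refine Filter.Tendsto.mono_right ?_ (pure_le_nhds 1)
    rw [Filter.tendsto_pure]
    filter_upwards [modNCyclotomicCharacter_eventually_eq_one K N] with σ hσ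
    simp only [hχ, MonoidHom.coe_comp, Function.comp_apply, hσ, map_one]

/-- Unfolding lemma: `dirichletGaloisCharacter ε σ = ε (χ_N σ)` in `ℂ`. [folklore] -/
@[simp] theorem coe_dirichletGaloisCharacter_apply (ε : DirichletCharacter ℂ N)
    (σ : absoluteGaloisGroup K) :
    ((dirichletGaloisCharacter K ε σ : ℂˣ) : ℂ) = ε (modNCyclotomicCharacter K N σ : ZMod N) :=
  rfl

/-- The range of `dirichletGaloisCharacter ε` is finite (it factors through `(ℤ/Nℤ)ˣ`). [folklore] -/
theorem finite_range_dirichletGaloisCharacter (ε : DirichletCharacter ℂ N) :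
    (Set.range (dirichletGaloisCharacter K ε)).Finite := by
  refine (Set.finite_range (fun u : (ZMod N)ˣ => ε.toUnitHom u)).subset ?_
  rintro _ ⟨σ, rfl⟩
  exact ⟨modNCyclotomicCharacter K N σ, rfl⟩

end CyclotomicModN

/-! ### Roots of unity of order prime to `𝔓` are distinct modulo `𝔓` -/

section RootsModP

variable {S : Type*} [CommRing S] [IsDomain S] {N : ℕ} [NeZero N]

/-- If `ζ` is a primitive `N`-th root of unity in a domain `S` and `𝔓` is an ideal not
containing `N`, then `1 - ζ^k ∈ 𝔓` forces `ζ^k = 1`: by Mathlib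
`IsPrimitiveRoot.prod_one_sub_pow_eq_order`, `∏_{0<k<N} (1 - ζ^k) = N`, so each `1 - ζ^k`
(`ζ^k ≠ 1`) divides `N`.  (The `N`-th roots of unity inject into `S/𝔓` when `N ∉ 𝔓`.)
Deliberately placed in Mathlib's `IsPrimitiveRoot` namespace (dot notation `hζ.…`).  Mathlib
has the special case `S = 𝓞 K` as `IsPrimitiveRoot.idealQuotient_mk` /
`Ideal.rootsOfUnityMapQuot_injective` (`Mathlib/NumberTheory/NumberField/Ideal/Basic.lean`);
the general-domain form is needed here for `S = \bar ℤ_K = absIntegers (𝓞 K) K`.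
Ref: Neukirch, *Algebraic Number Theory*, Ch. I §10, proof of (10.3); Washington,
*Cyclotomic Fields*, Lemma 2.12. [folklore] -/
theorem _root_.IsPrimitiveRoot.pow_eq_one_of_one_sub_pow_mem {ζ : S} (hζ : IsPrimitiveRoot ζ N)
    {𝔓 : Ideal S} (hN : (N : S) ∉ 𝔓) {k : ℕ} (hk : 1 - ζ ^ k ∈ 𝔓) : ζ ^ k = 1 := by
  obtain ⟨n, rfl⟩ : ∃ n, N = n + 1 := Nat.exists_eq_succ_of_ne_zero (NeZero.ne N)
  -- reduce the exponent mod `N`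
  have hkmod : ζ ^ k = ζ ^ (k % (n + 1)) := by
    conv_lhs => rw [← pow_mod_orderOf ζ k, ← hζ.eq_orderOf]
  rw [hkmod] at hk ⊢
  rcases Nat.eq_zero_or_pos (k % (n + 1)) with h0 | hpos
  · rw [h0, pow_zero]
  · exfalso
    apply hN
    obtain ⟨m, hm⟩ : ∃ m, k % (n + 1) = m + 1 := Nat.exists_eq_succ_of_ne_zero hpos.ne'
    have hmn : m < n := by
      have := Nat.mod_lt k (by omega : 0 < n + 1)
      omega
    have hdvd : (1 - ζ ^ (m + 1)) ∣ ((n + 1 : ℕ) : S) := by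
      rw [Nat.cast_succ, ← hζ.prod_one_sub_pow_eq_order]
      exact Finset.dvd_prod_of_mem (fun k => 1 - ζ ^ (k + 1)) (Finset.mem_range.mpr hmn)
    obtain ⟨c, hc⟩ := hdvd
    rw [hc]
    rw [hm] at hk
    exact 𝔓.mul_mem_right c hk

/-- Two powers of a primitive `N`-th root of unity congruent modulo a prime ideal `𝔓 ∌ N`
are equal (deliberate extension of Mathlib's `IsPrimitiveRoot` namespace; cf.
`Ideal.rootsOfUnityMapQuot_injective` for `𝓞 K`). [folklore] -/
theorem _root_.IsPrimitiveRoot.pow_eq_pow_of_sub_mem {ζ : S} (hζ : IsPrimitiveRoot ζ N)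
    {𝔓 : Ideal S} [𝔓.IsPrime] (hN : (N : S) ∉ 𝔓) {i j : ℕ} (h : ζ ^ i - ζ ^ j ∈ 𝔓) :
    ζ ^ i = ζ ^ j := by
  have hζu : IsUnit ζ := hζ.isUnit (NeZero.ne N)
  have hζ𝔓 : ∀ l : ℕ, ζ ^ l ∉ 𝔓 := fun l hl =>
    Ideal.IsPrime.ne_top ‹_› (Ideal.eq_top_of_isUnit_mem _ hl (hζu.pow l))
  wlog hij : i ≤ j generalizing i j
  · exact (this (by rwa [← neg_sub, neg_mem_iff]) (le_of_not_ge hij)).symm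
  obtain ⟨d, rfl⟩ := Nat.exists_eq_add_of_le hij
  have hfac : ζ ^ i - ζ ^ (i + d) = ζ ^ i * (1 - ζ ^ d) := by ring
  rw [hfac] at h
  rcases Ideal.IsPrime.mem_or_mem ‹_› h with h1 | h2
  · exact absurd h1 (hζ𝔓 i)
  · rw [pow_add, hζ.pow_eq_one_of_one_sub_pow_mem hN h2, mul_one]

end RootsModP

/-! ### Values of the mod `N` cyclotomic character: inertia, Frobenius, complex conjugation -/

section Values

variable {K : Type*} [Field K] [NumberField K] {N : ℕ} [NeZero N]

/-- A primitive `N`-th root of unity in `\bar ℤ_K = absIntegers (𝓞 K) K` (it is integral,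
being a root of `X^N - 1`), for `N ≠ 0`. [folklore] -/
theorem exists_isPrimitiveRoot_absIntegers (K : Type*) [Field K] [NumberField K] (N : ℕ)
    [NeZero N] : ∃ ζ : absIntegers (𝓞 K) K, IsPrimitiveRoot ζ N := by
  haveI : NeZero (N : K) := NeZero.charZero
  obtain ⟨z, hz⟩ := HasEnoughRootsOfUnity.exists_primitiveRoot (AlgebraicClosure K) N
  have hint : IsIntegral (𝓞 K) z := (hz.isIntegral (NeZero.pos N)).tower_top
  refine ⟨⟨z, hint⟩, ?_⟩
  exact IsPrimitiveRoot.of_map_of_injective (f := (absIntegers (𝓞 K) K).val)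
    (by exact hz) Subtype.val_injective

variable [NeZero (N : K)]

omit [NumberField K] in
/-- The action of `σ ∈ Γ_K` on a primitive `N`-th root of unity `ζ ∈ \bar ℤ_K`, inside
`\bar ℤ_K`: `σ • ζ = ζ ^ χ_N(σ)`. [folklore] -/
theorem smul_eq_pow_modNCyclotomicCharacter (σ : absoluteGaloisGroup K)
    {ζ : absIntegers (𝓞 K) K} (hζ : IsPrimitiveRoot ζ N) :
    σ • ζ = ζ ^ ((modNCyclotomicCharacter K N σ : ZMod N)).val := by
  apply Subtype.val_injective
  rw [integralClosure.coe_smul, SubmonoidClass.coe_pow]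
  exact modNCyclotomicCharacter_spec K N σ _ (by
    rw [← SubmonoidClass.coe_pow, hζ.pow_eq_one]; rfl)

/-- **The mod `N` cyclotomic character is unramified at primes not dividing `N`:** if
`𝔓 ∌ N` is a prime of `\bar ℤ_K` and `σ` lies in the inertia group `I_𝔓`, then `χ_N(σ) = 1`
(`σ ζ ≡ ζ (mod 𝔓)` forces `σ ζ = ζ`).
Ref: Neukirch, *Algebraic Number Theory*, Ch. I (10.3)–(10.4) (`p ∤ N` is unramified in
`ℚ(ζ_N)`); Washington, *Cyclotomic Fields*, Prop. 2.3. [folklore] -/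
theorem modNCyclotomicCharacter_eq_one_of_mem_inertia {𝔓 : Ideal (absIntegers (𝓞 K) K)}
    [𝔓.IsPrime] (hN : (N : absIntegers (𝓞 K) K) ∉ 𝔓) {σ : absoluteGaloisGroup K}
    (hσ : σ ∈ 𝔓.inertia (absoluteGaloisGroup K)) : modNCyclotomicCharacter K N σ = 1 := by
  obtain ⟨ζ, hζ⟩ := exists_isPrimitiveRoot_absIntegers K N
  have h1 : σ • ζ - ζ ∈ 𝔓 := hσ ζ
  rw [smul_eq_pow_modNCyclotomicCharacter σ hζ] at h1
  have h1' : ζ ^ ((modNCyclotomicCharacter K N σ : ZMod N)).val - ζ ^ 1 ∈ 𝔓 := by rwa [pow_one]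
  have h2 := hζ.pow_eq_pow_of_sub_mem hN h1'
  have hζ' : IsPrimitiveRoot (ζ : AlgebraicClosure K) N :=
    hζ.map_of_injective (f := (absIntegers (𝓞 K) K).val) Subtype.val_injective
  ext
  rw [Units.val_one, ← Nat.cast_one]
  refine modNCyclotomicCharacter_eq_of_smul_eq_pow K N hζ' σ ?_
  rw [← integralClosure.coe_smul, smul_eq_pow_modNCyclotomicCharacter σ hζ, h2]
  rfl

/-- **The mod `N` cyclotomic character of an arithmetic Frobenius is the residue cardinality:**
if `𝔓 ∌ N` is a prime of `\bar ℤ_K` above the finite place `v` and `σ` is an arithmetic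
Frobenius at `𝔓` (`σ x ≡ x^{N v} (mod 𝔓)`), then `χ_N(σ) = N v (mod N)`
(`σ ζ ≡ ζ^{N v}` forces `σ ζ = ζ^{N v}`).  For `K = ℚ`: `χ_N(Frob_p) = p`.
Ref: Neukirch, *Algebraic Number Theory*, Ch. I (10.3) and Ch. VII §5 (proof of (5.6),
"`φ_p : ζ ↦ ζ^p`"); Washington, *Cyclotomic Fields*, Lemma 2.12 ff. [folklore] -/
theorem modNCyclotomicCharacter_eq_residueCard_of_isArithFrobAt {v : HeightOneSpectrum (𝓞 K)}
    {𝔓 : Ideal (absIntegers (𝓞 K) K)} (h𝔓 : 𝔓 ∈ v.primesAbove)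
    (hN : (N : absIntegers (𝓞 K) K) ∉ 𝔓) {σ : absoluteGaloisGroup K}
    (hσ : IsArithFrobAt (𝓞 K) σ 𝔓) :
    (modNCyclotomicCharacter K N σ : ZMod N) = v.residueCard := by
  haveI : 𝔓.IsPrime := h𝔓.1
  obtain ⟨ζ, hζ⟩ := exists_isPrimitiveRoot_absIntegers K N
  have h1 : σ • ζ - ζ ^ v.residueCard ∈ 𝔓 :=
    (HeightOneSpectrum.isArithFrobAt_iff_of_mem_primesAbove h𝔓 σ).mp hσ ζ
  rw [smul_eq_pow_modNCyclotomicCharacter σ hζ] at h1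
  have h2 := hζ.pow_eq_pow_of_sub_mem hN h1
  have hζ' : IsPrimitiveRoot (ζ : AlgebraicClosure K) N :=
    hζ.map_of_injective (f := (absIntegers (𝓞 K) K).val) Subtype.val_injective
  refine modNCyclotomicCharacter_eq_of_smul_eq_pow K N hζ' σ ?_
  rw [← integralClosure.coe_smul, smul_eq_pow_modNCyclotomicCharacter σ hζ, h2]
  rfl

omit [NumberField K] in
/-- **Complex conjugation acts on roots of unity by inversion:** for a complex conjugation
`c ∈ Γ_K` (`Literature.IsComplexConjugation φ c`: `ι(c x) = conj(ι x)` for an embedding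
`ι : K̄ → ℂ`), `χ_N(c) = -1`, since `conj z = z⁻¹` on the unit circle.
Ref: Deligne–Serre 1974, 4.5; Washington, *Cyclotomic Fields*, p. 19 (`χ(-1) = χ(c)`). [folklore] -/
theorem modNCyclotomicCharacter_of_isComplexConjugation {φ : K →+* ℝ} {c : absoluteGaloisGroup K}
    (hc : IsComplexConjugation φ c) : (modNCyclotomicCharacter K N c : ZMod N) = -1 := by
  obtain ⟨ι, -, hι⟩ := isComplexConjugation_iff.mp hc
  obtain ⟨ζ, hζ⟩ := HasEnoughRootsOfUnity.exists_primitiveRoot (AlgebraicClosure K) N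
  obtain ⟨n, hn⟩ : ∃ n, N = n + 1 := Nat.exists_eq_succ_of_ne_zero (NeZero.ne N)
  have hzN : (ι ζ) ^ N = 1 := by rw [← map_pow, hζ.pow_eq_one, map_one]
  have hnorm : ‖ι ζ‖ = 1 := Complex.norm_eq_one_of_pow_eq_one hzN (NeZero.ne N)
  have hcζ : c • ζ = ζ ^ n := by
    apply ι.injective
    rw [hι, ← Complex.inv_eq_conj hnorm, map_pow]
    rw [hn, pow_succ] at hzN
    exact inv_eq_of_mul_eq_one_left hzN
  rw [modNCyclotomicCharacter_eq_of_smul_eq_pow K N hζ c hcζ]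
  have h0 : ((n : ℕ) : ZMod N) + 1 = 0 := by
    have : ((n + 1 : ℕ) : ZMod N) = 0 := by rw [← hn, ZMod.natCast_self]
    exact_mod_cast this
  exact eq_neg_of_add_eq_zero_left h0

end Values

/-! ### `K = ℚ`: primes not dividing `N` -/

section RatN

open Rat.HeightOneSpectrum

/-- For a prime `𝔓` of `\bar ℤ` above the rational prime `p ∤ N`, `N ∉ 𝔓`
(`𝔓 ∩ ℤ = pℤ`; Mathlib `Rat.HeightOneSpectrum.natGenerator_dvd_iff`). [folklore] -/
theorem Rat.natCast_not_mem_of_mem_primesAbove_of_not_dvd {N : ℕ} {v : HeightOneSpectrum (𝓞 ℚ)}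
    {𝔓 : Ideal (absIntegers (𝓞 ℚ) ℚ)} (h𝔓 : 𝔓 ∈ v.primesAbove)
    (hN : ¬ ((primesEquiv v : Nat.Primes) : ℕ) ∣ N) : (N : absIntegers (𝓞 ℚ) ℚ) ∉ 𝔓 := by
  intro hmem
  apply hN
  have h1 : (N : 𝓞 ℚ) ∈ 𝔓.under (𝓞 ℚ) := by
    rw [Ideal.under_def, Ideal.mem_comap, map_natCast]
    exact hmem
  rw [← h𝔓.2.over] at h1
  have h2 := Ideal.mem_map_of_mem (Rat.IsIntegralClosure.intEquiv (𝓞 ℚ)) h1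
  rw [map_natCast] at h2
  exact (natGenerator_dvd_iff v).mpr h2

end RatN

/-! ### Rank-one framed representations -/

namespace FramedRep

variable {G : Type*} [Group G] [TopologicalSpace G] {A : Type*} [CommRing A] [TopologicalSpace A]

/-- The rank-one framed representation `G →ₜ* GL (Fin 1) A` attached to a continuous character
`χ : G →ₜ* Aˣ` (through `FramedRep.unitsContinuousMulEquivOfUnique`). [folklore] -/
def ofCharacter (χ : G →ₜ* Aˣ) : FramedRep G A 1 :=
  ContinuousMonoidHom.comp
    (unitsContinuousMulEquivOfUnique (Fin 1) A : Aˣ →ₜ* GL (Fin 1) A) χ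

/-- Matrix entries of `ofCharacter χ g`: all equal to `χ g`. [folklore] -/
@[simp] theorem ofCharacter_apply_coe (χ : G →ₜ* Aˣ) (g : G) (i j : Fin 1) :
    ((ofCharacter χ g : GL (Fin 1) A) : Matrix (Fin 1) (Fin 1) A) i j = χ g := rfl

/-- `ofCharacter` is injective: the character is the `(0,0)` entry. [folklore] -/
theorem ofCharacter_injective : Function.Injective (ofCharacter (G := G) (A := A)) := by
  intro χ χ' h
  ext g
  have := congrArg (fun ρ : FramedRep G A 1 => ((ρ g : GL (Fin 1) A) : Matrix (Fin 1) (Fin 1) A) 0 0) h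
  simpa using this

/-- The range of `ofCharacter χ` is finite if the range of `χ` is. [folklore] -/
theorem finite_range_ofCharacter {χ : G →ₜ* Aˣ} (h : (Set.range χ).Finite) :
    (Set.range (ofCharacter χ)).Finite := by
  have : Set.range (ofCharacter χ) =
      (unitsContinuousMulEquivOfUnique (Fin 1) A : Aˣ → GL (Fin 1) A) '' Set.range χ := by
    rw [← Set.range_comp]; rfl
  rw [this]
  exact h.image _

/-- `FramedGaloisRep.cyclotomic` (`Literature.NumberTheory.GaloisRepresentations.GaloisRep`)
is literally `ofCharacter` of the `ℓ`-adic cyclotomic character. [folklore] -/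
theorem _root_.Literature.NumberTheory.GaloisRepresentations.FramedGaloisRep.cyclotomic_eq_ofCharacter (K : Type*) [Field K] (ℓ : ℕ)
    [Fact ℓ.Prime] :
    FramedGaloisRep.cyclotomic K ℓ = ofCharacter (GaloisRep.cyclotomicCharacter K ℓ) := rfl

/-- The characteristic polynomial of `ofCharacter χ g` is `X - χ g`. [folklore] -/
theorem charpoly_ofCharacter [IsTopologicalRing A] (χ : G →ₜ* Aˣ) (g : G) :
    charpoly (ofCharacter χ) g = X - C ((χ g : Aˣ) : A) := by
  unfold charpoly
  rw [Matrix.charpoly, Matrix.det_unique, Matrix.charmatrix_apply_eq, ofCharacter_apply_coe]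

end FramedRep

/-! ### Rank-one framed representations over a field: semisimple, determined up to equivalence -/

namespace FramedRep

variable {G : Type*} [Group G] [TopologicalSpace G] {k : Type*} [Field k] [TopologicalSpace k]
  [IsTopologicalRing k]

/-- A rank-one representation over a field is semisimple (indeed simple: its only
subrepresentations are `⊥` and `⊤`). [folklore] -/
theorem isSemisimple_of_rank_one (ρ : FramedRep G k 1) : ρ.toContinuousRep.IsSemisimple := by
  haveI hs : IsSimpleModule k (Fin 1 → k) := isSimpleModule_iff_finrank_eq_one.mpr (by simp)
  haveI : IsSimpleOrder (Subrepresentation ρ.toContinuousRep.toRepresentation) :=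
    { exists_pair_ne := ⟨⊥, ⊤, fun h => by
        have h' := congrArg Subrepresentation.toSubmodule h
        exact (bot_ne_top (α := Submodule k (Fin 1 → k))) h'⟩
      eq_bot_or_eq_top := fun W => by
        rcases eq_bot_or_eq_top W.toSubmodule with h | h
        · left; exact Subrepresentation.toSubmodule_injective h
        · right; exact Subrepresentation.toSubmodule_injective h }
  show ComplementedLattice _
  infer_instance

/-- Two rank-one framed representations over a field whose underlying continuous
representations are equivalent are **equal** (a one-dimensional intertwiner is a nonzero
scalar, and `GL₁` is commutative). [folklore] -/
theorem eq_of_equiv_of_rank_one (ρ ρ' : FramedRep G k 1)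
    (e : ContinuousRep.Equiv ρ.toContinuousRep ρ'.toContinuousRep) : ρ = ρ' := by
  -- the intertwiner sends `u = (1)` to a nonzero vector `w`
  set u : Fin 1 → k := fun _ => 1 with hu
  have hu0 : u ≠ 0 := fun h => one_ne_zero (congrFun h 0)
  set w : Fin 1 → k := e.toLinearEquiv u with hw
  have hw0 : w 0 ≠ 0 := by
    intro h0
    apply hu0
    have : w = 0 := funext fun i => by rw [Subsingleton.elim i 0]; exact h0
    exact e.toLinearEquiv.injective (by rw [← hw, this, map_zero])
  apply DFunLike.ext; intro g; apply Units.ext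
  ext i j
  rw [Subsingleton.elim i 0, Subsingleton.elim j 0]
  -- compare the `0`-entries of `e (ρ g u) = ρ' g (e u)`
  have key := e.apply_apply g u
  have lhs : e.toLinearEquiv (ρ.toContinuousRep g u) =
      (((ρ g : GL (Fin 1) k) : Matrix (Fin 1) (Fin 1) k) 0 0) • w := by
    have : ρ.toContinuousRep g u = (((ρ g : GL (Fin 1) k) : Matrix (Fin 1) (Fin 1) k) 0 0) • u := by
      funext i
      rw [Subsingleton.elim i 0, toContinuousRep_apply_apply, Matrix.mulVec, Pi.smul_apply]
      simp [dotProduct, hu]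
    rw [this, map_smul]
  have rhs : ρ'.toContinuousRep g w = (((ρ' g : GL (Fin 1) k) : Matrix (Fin 1) (Fin 1) k) 0 0) • w := by
    funext i
    rw [Subsingleton.elim i 0, toContinuousRep_apply_apply, Matrix.mulVec, Pi.smul_apply]
    simp [dotProduct, Finset.univ_unique]
  rw [lhs, rhs] at key
  have := congrFun key 0
  simp only [Pi.smul_apply, smul_eq_mul] at this
  exact mul_right_cancel₀ hw0 this

end FramedRep

end Literature.NumberTheory.GaloisRepresentations
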